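import Mathlib
import HarnessLib
import HarnessLib.Audit
import Summits.AtomisticToContinuum.Statement
import Literature.MathematicalPhysics.QuantumManyBody.PeriodicBoseGas
import Literature.MathematicalPhysics.QuantumManyBody.BoseGasStructureFactor
import Summits.AtomisticToContinuum.BoseEinsteinCondensation.Theorems.BECFisherTransferPeriodicOccupationStability
import HarnessLib.Audit.Status.Attr

/-!
Route: BECLiebAntibunching

# Route BECLiebAntibunching — Lieb's anti-bunching g₂ ≤ 1 frees the whole pair part of the
Palm–Jensen landscape mean; BEC from anti-bunching plus a bounded non-pairwise remainder

It suffices to show X = AntibunchingGS ∧ NonPairwisePalmMean ∧ HardCorePalmAffinity on the TORUS of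
side L = (N/ρ)^{1/3}
(card lieb-antibunching-g2 as spine, consuming the Palm–Jensen mean of card palm-kl-sum-rule).
AntibunchingGS (Lieb's 1963
working hypothesis g ≤ 1 as a theorem, finite-N form): for every BOUNDED repulsive finite-range v,
all small ρ, some C, all
large N = n+2, the positive translation-invariant periodic ground state Ψ₀ has translation-averaged
Born pair density
P(y) = L³∫_{cell^{n+1}}|Ψ₀(x₂+y, x₂, …)|² ≤ 1 + C/N at EVERY separation y (uncorrelated value 1; g₂
= (1−1/N)P).
NonPairwisePalmMean: for some bounded even periodic one-body profile u (free to choose, |u| ≤ U₀)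
the Palm mean of the
NON-pairwise landscape R = −log Ψ₀ − Σ_j u(·−y_j) is bounded: E_{P_x}[R(y,·) − R(x,·)] ≤ C uniformly
in x, y, N.
HardCorePalmAffinity: the Palm affinity bound for the unbounded (hard-core) members of the class,
filed as its own crux.
The support AntibunchingPalmGlue (provable now) turns X into PalmAffinityBound — the target of route
BECRieszShadow
(stmt-AtomisticToContinuum-9157, shared verbatim) — because anti-bunching gives L¹ hole control
∫_cell|P−1| ≤ 2CL³/N,
which makes the pair part of the Palm mean ≤ 4C·U₀ for ANY bounded u by the exact translation
cancellation (no positive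
type, no screening, no Parseval), and PalmJensen (stmt-9162) then gives γ(x,y) ≥ e^{−C_B−4CU₀}ρ;
BECRieszShadow's frame
(PeriodicRigidity 9467, PalmAffinityFlatMode 9163, PeriodicOccupationStability 9164,
AffinityFrameGlue 9165,
BoundaryTransferWeak 0827 — all shared verbatim) carries PalmAffinityBound to the conjunct.
Lean: `AntibunchingGS ∧ NonPairwisePalmMean ∧ HardCorePalmAffinity`

## Assembly
Pure logic once the two glue items are in hand (10 hypotheses, all items of this route). The
DECIDING THEOREM (glue.lean, elaborates sorry-free, axioms
propext/Classical.choice/Quot.sound): `theorem closes (hA : AntibunchingGS) (hB :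
NonPairwisePalmMean)
(hC : PositiveGroundState) (hD : HardCorePalmAffinity) (hG₁ : AntibunchingPalmGlue) (hR :
PeriodicRigidity)
(hF : PalmAffinityFlatMode) (hS : PeriodicOccupationStability) (hG : AffinityFrameGlue) (hT :
BoundaryTransferWeak) :
BoseEinsteinCondensation := fun v hv => hT v hv ((hG (hG₁ hA hB hC hD) hR hF hS) v hv)`:
AntibunchingPalmGlue turns X (with the known PositiveGroundState; PalmJensen, stmt-9162, is the
lemma its proof uses)
into PalmAffinityBound;
AffinityFrameGlue turns that, with PeriodicRigidity and the two stability supports, into the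
PeriodicBEC body for v;
BoundaryTransferWeak v hv reads off ∃ρ₀ ∀ρ<ρ₀ HasGroundStateBEC v ρ, i.e. the conjunct
`BoseEinsteinCondensation` (root
abbrev of Summits/AtomisticToContinuum/BoseEinsteinCondensation/Statement.lean, = the Literature
constant by Iff.rfl).

Rationale: WHY THIS LINE. Positivity of Ψ₀ makes γ(x,y)/ρ a Palm average of the ratio Ψ₀(y,·)/Ψ₀(x,·) and one
Jensen bounds it below by
exp(−Palm mean of the landscape increment) (Reatto1969, McMillan1965, PenroseOnsager1956; in-tree
BECRieszShadow,
BECPalmLandscape). Every such line must pay for the PAIR part of −log Ψ₀ (the 2a/r scattering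
correlation and its
screened/phonon tails): BECRieszShadow pays with conditional positive-definiteness of u and still
needs sup g₂ < ∞ for
the short-range piece; palm-kl-sum-rule pays with Parseval and a bounded structure factor plus UV
decay of 1−S. New here
(found while planning, elementary): Lieb's anti-bunching in L¹ form, ρ∫|g₂−1| ≤ 1+2C, makes the
ENTIRE pair part free
for any bounded u — |E_{P_x}Σ_j[u(y−y_j)−u(x−y_j)]| ≤ 2‖u‖_∞·ρ∫|g₂−1| — so the route isolates two
clean objects: the sign
structure of the Born pair function (Lieb1963 assumed 0 ≤ u ≤ 1; CarlenJauslinLieb2021 prove it for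
the simple equation
only; IsiharaYee1964 / GiorginiBoronatCasulleras1999 give the dilute hard-sphere g(r) below 1) and
the non-pairwise
Palm mean. Imported areas: point processes / Palm calculus and relative entropy (probability), the
Lieb 1963 pair
hierarchy and quantum-chemistry contracted-Schrödinger identities (Δ_yP = e·P for the positive
eigenfunction, used only
in the engine of rank 2), DMC data as falsifier. By-hand audit done here: the card's bare
maximum-principle engine does
NOT survive finite-size bookkeeping (the conditional energy excess has e(∞) = −8πa/L³, so the
admissible overshoot εL²
is ≫ C/N), hence anti-bunching itself, not the card's K1/K2, is filed as the crux; the negatives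
index (one SwapJensen
sign slip) is not touched.

RANKED CRUXES. #0 PalmAffinityBound (target) — shared verbatim with route BECRieszShadow
(stmt-AtomisticToContinuum-9157): for every admissible v, ρ < ρ₀(v), some C, eventually in N = n+1,
for every δ > 0 a nonnegative periodic δ-near-minimiser Ψ with ∫_{cell^n}|Ψ(x,Y)|² dY ≤ e^C
∫_{cell^n}|Ψ(x,Y)||Ψ(y,Y)| dY for all x, y (uniform-in-separation ODLRO of a positive near-ground
state). Here it is the node reached from X by AntibunchingPalmGlue. (why it might fail:
uniform-in-separation ODLRO with e^(−C) needs control at all r ≤ L√3/2; an unscreened collective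
tail of −log Ψ₀ would leave only γ ≥ ρN^(−ε); hard cores enter through the void conditioning
(HardCorePalmAffinity).) [Reatto1969, PenroseOnsager1956, LSSY2005, ReattoChester1967]
#2 AntibunchingGS (crux) — ANTI-BUNCHING OF THE DILUTE GROUND STATE (card K1+K2 fused into their
conclusion; Lieb's g ≤ 1 in finite-N form). For every repulsive finite-range v that is bounded (v ≤
M < ∞) there is ρ₀ > 0 such that for 0 < ρ < ρ₀ there is C with, for all large N = n+2 and L =
(N/ρ)^{1/3}: every positive, translation-invariant periodic trial state attaining the periodic
ground-state energy (the ground state Ψ₀; it exists and is unique up to phase, PositiveGroundState)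
has translation-averaged Born pair density P(y) = L³∫_{cell^{n+1}}|Ψ₀(x₂+y, x₂, x₃, …)|² dX ≤ 1 +
C/N for EVERY y ∈ ℝ³ (P has cell-mean 1, P ≡ 1 for the free gas, g₂ = (1−1/N)P; the canonical far
field is P ≈ 1 + 1/N, so C ≥ 1 is expected; Bogoliubov: g₂ − 1 = ρ⁻¹∫(S−1)e^{iky}đk < 0 at every r
with S = k/√(k²+16πρa), checked numerically on the card; dilute hard spheres: IsiharaYee1964, DMC
GiorginiBoronatCasulleras1999). Consequences filed as support: S_N(k) ≤ 1+2C (AntibunchingBoundsS);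
voids P_x(B_a(y) occupied) ≤ (4π/3)ρa³(1+C/N). [deps: PositiveGroundState] [difficulty:
open-problem] (why it might fail: False at liquid density (DMC shell peaks), so ρ₀(v) is essential;
only Bogoliubov/CJL-simple-equation/low-order hard-sphere evidence; the card's max-principle handle
fails at finite L (e(∞) = −8πa/L³ ≫ C/(ρL⁵)), so no engine is in hand; soft wide v (a ≪ R₀) untested
inside the range.) [Lieb1963, CarlenJauslinLieb2021, IsiharaYee1964, GiorginiBoronatCasulleras1999,
LSSY2005]
#3 NonPairwisePalmMean (crux) — PALM MEAN OF THE NON-PAIRWISE LANDSCAPE (card palm-kl-sum-rule K1,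
typed with a FREE BOUNDED profile). For every bounded repulsive finite-range v there is ρ₀ such that
for 0 < ρ < ρ₀ there are U₀, C with, for all large N = n+2, a continuous, bounded (|u| ≤ U₀), even,
Lℤ³-periodic u : ℝ³ → ℝ such that every positive translation-invariant periodic ground state Ψ₀ (as
in AntibunchingGS) satisfies, for all x, y ∈ ℝ³: ∫_{cell^{n+1}} Ψ₀(x,Y)² [log(Ψ₀(x,Y)/Ψ₀(y,Y)) − Σ_j
(u(y−Y_j) − u(x−Y_j))] dY ≤ C ∫_{cell^{n+1}} Ψ₀(x,Y)² dY, i.e. E_{P_x}[R(y,·) − R(x,·)] ≤ C for R =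
−log Ψ₀ − Σ_j u(·−Y_j) (the pairwise u–u terms among the bath cancel in the difference). u is meant
to absorb the whole two-body structure of log Ψ₀ (capped scattering solution −log f, Reatto–Chester
1/r² tail, any bounded profile): given AntibunchingGS its Palm mean is free, so only ≥3-body /
collective structure is at stake; with u ≡ 0 the item is ½·TeleportEntropyBound of BECRieszShadow
(stmt-9158), hence weaker than it. [deps: AntibunchingGS] [difficulty: open-problem] (why it might
fail: R keeps the ≥3-body/collective zero-point part of −log Ψ₀: u₃ ≍ (r₁r₂)⁻² against slowly
decaying 3-point correlations could give a log L drift; E[p_y/p_x]=1 ties the mean to a variance in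
the Gaussian regime (IR problem relocated); given rank 2 it is equivalent to TeleportEntropyBound.)
[Reatto1969, ReattoChester1967, McMillan1965, CarlenJauslinLieb2020]
#4 HardCorePalmAffinity (crux) — HARD-CORE PALM AFFINITY: the body of PalmAffinityBound for the
members of the class that are NOT bounded (v taking the value ⊤ or unbounded finite values: hard
spheres, hard core plus tail). Filed as a crux because the positivity engine above is typed on exact
C¹ ground states, which do not exist for hard cores (Ψ₀ is Lipschitz at contact): the ∃-witness must
be a C¹ near-minimiser approximating Ψ₀, with the event-conditioned Jensen γ(x,y)/ρ ≥
P_x(A_y)·exp(−E[Δ | A_y]), P_x(A_y) ≥ 1 − (4π/3)ρa³ sup g₂ (anti-bunching of the approximant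
supplies the void bound). [deps: AntibunchingGS, NonPairwisePalmMean] [difficulty: open-problem]
(why it might fail: The hard-core Ψ₀ is not C¹, so slice integrals of C¹ approximants must converge
uniformly in x,y; void conditioning needs anti-bunching of the approximant itself;
jammed/disconnected components of the fixed-N hard-sphere torus configuration space; nothing in
print.) [LSSY2005, PenroseOnsager1956, Reatto1969, GiorginiBoronatCasulleras1999]
#5 BoundaryTransferWeak (crux) — shared verbatim with routes BECPeriodicReduction / BECRieszShadow
(stmt-AtomisticToContinuum-0827): for each repulsive finite-range v, PeriodicBEC(v) (constant-mode
occupation ≥ cN for δ-near-minimisers of the periodic energy at all small ρ) implies ∃ρ₀>0 ∀ρ∈(0,ρ₀)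
HasGroundStateBEC v ρ (Dirichlet ground state, mode-free). [difficulty: L] (why it might fail:
PeriodicBEC(v) is ground-state-only (δ after N): the Dirichlet ground state restricted to interior
cells is neither periodic nor of sharp N and lies a wall term ≫ δ above E₀^per, so the hypothesis
may never fire; only the ENERGY transfer is in print; BEC is BC-sensitive.) [LSSY2005, Fournais2020,
arXiv:2603.20776]
#6 PeriodicRigidity (crux) — shared verbatim with route BECRieszShadow
(stmt-AtomisticToContinuum-9467): for every admissible v, ρ < ρ₀(v), every η > 0, eventually in N,
there is δ > 0 such that any two δ-near-minimisers Ψ, Φ of the periodic energy (L = (N/ρ)^{1/3})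
satisfy ∫_{cell^N}|Ψ − cΦ|² ≤ η for some unit complex c (compact resolvent, unique positive ground
state and a spectral gap at fixed N). Used only inside AffinityFrameGlue (η := e^{−C}/4 before N).
[difficulty: M] (why it might fail: v = ⊤ walls (hard cores, hollow impenetrable shells) disconnect
the fixed-N configuration space; uniqueness then needs every non-dilute component (jammed or bound
clusters) to lie an N-uniform gap above E₀^per; E₀^per = ⊤ would make the item vacuous-false.)
[ReedSimonIV1978, LSSY2005, Fournais2020]
#9 PositiveGroundState (support) — KNOWN RESULT (existence, positivity, regularity, translation
invariance of the periodic ground state for bounded potentials): for every bounded repulsive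
finite-range v, every N ≥ 1 and L > 0 there is a periodic C¹ trial state attaining
periodicGroundStateEnergy v N L which is strictly positive and invariant under simultaneous
translation of all particles (H = −ΣΔ_i + Σ v^per(x_i−x_j) on the flat torus with V ∈ L^∞: compact
resolvent, the form infimum over the C¹ core equals inf spec and is attained by the eigenfunction,
which is W^{2,p} for all p hence C^{1,α}; Perron–Frobenius / Harnack give uniqueness and strict
positivity, and uniqueness plus translation invariance of H give invariance of Ψ₀). Supplies the
object AntibunchingGS and NonPairwisePalmMean quantify over. [difficulty: L] [ReedSimonIV1978,
GilbargTrudinger2001, Fournais2020]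
#9 AntibunchingBoundsS (support) — ANTI-BUNCHING BOUNDS THE STRUCTURE FACTOR (provable now; the
stand-alone deliverable "S ≤ 2" of the card in finite-N form). For L > 0, C ≥ 0, any n and any
periodic trial state Ψ of n+2 bosons with L³∫_{cell^{n+1}}|Ψ((X₀+y)::X)|² dX ≤ 1 + C/(n+2) for all
y: N·S_N(k) = structureFactorVar ≤ (1+2C)·N for every k = 2πm/L, m ≠ 0. Proof: N S_N(k) = Var ρ̂_k ≤
E|ρ̂_k|² = N + N(N−1)·L⁻³∫_cell cos(k·y)P(y)dy (Bose symmetry; Tonelli along x₁ = x₂ + y using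
periodicity in particle 1), ∫_cell cos(k·y)dy = 0 for m ≠ 0, and ∫_cell|P−1| ≤ 2L³C/N. [difficulty:
provable-now] [Stringari1995, Lieb1963, IsiharaYee1964]
#9 PalmJensen (support) — shared verbatim with route BECRieszShadow
(stmt-AtomisticToContinuum-9162): PALM–JENSEN. For a continuous strictly positive ψ on
(n+1)-configurations with x-independent slice mass Z = ∫_{cell^n} ψ(x,Y)² dY: if ∫ψ(x,Y)²
log(ψ(x,Y)²/ψ(y,Y)²) dY ≤ K·Z for all x, y then e^{−K/2} Z ≤ ∫ψ(x,Y)ψ(y,Y) dY (Jensen for exp under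
p_x = ψ(x,·)²/Z). [difficulty: provable-now] [Reatto1969, McMillan1965, PenroseOnsager1956]
#9 AntibunchingPalmGlue (support) — THE NEW GLUE (provable now; the route's elementary observation).
AntibunchingGS → NonPairwisePalmMean → PositiveGroundState → HardCorePalmAffinity →
PalmAffinityBound, using the support PalmJensen (stmt-9162, provable now) as a lemma. Proof: fix v;
if v is unbounded, HardCorePalmAffinity is the claim. If v is bounded: ρ₀ := min(ρ₀^A, ρ₀^B); for ρ
< ρ₀ take C_A, (U₀, C_B) and, eventually in n, the profile u and the witness Ψ₀ of
PositiveGroundState at (n+2, L); Ψ₀ is an exact minimiser, hence a δ-near-minimiser for every δ > 0,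
and real positive, hence Ψ.ψ = ‖Ψ.ψ‖. Translation invariance plus periodicity give x-independent
slice mass m_x = ∫_{cell^{n+1}}Ψ₀(x,Y)² dY = L⁻³ and q_x(z) := ∫_{cell^n}Ψ₀(x,z,Y′)² dY′ =
P(x−z)/L⁶. Bose symmetry in Y and the EXACT CANCELLATION ∫_cell[u(y−z) − u(x−z)]dz = 0 (u periodic)
give ∫Ψ₀(x,Y)² Σ_j[u(y−Y_j) − u(x−Y_j)] dY = (n+1)L⁻⁶∫_cell[u(y−z)−u(x−z)](P(x−z)−1)dz ≤
(n+1)L⁻⁶·2U₀·∫_cell|P−1| ≤ (n+1)L⁻⁶·2U₀·2L³max(C_A,0)/(n+2) ≤ 4U₀max(C_A,0)·m_x (anti-bunching: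
∫_cell(P−1)₊ ≤ L³max(C_A,0)/N and ∫_cell(P−1) = 0). Hence ∫Ψ₀(x,Y)² log(Ψ₀(x,Y)²/Ψ₀(y,Y)²) dY ≤
K·m_x with K := 2C_B + 8U₀max(C_A,0); PalmJensen (continuous, strictly positive, equal slice masses)
gives e^{−K/2}m_x ≤ ∫Ψ₀(x,Y)Ψ₀(y,Y)dY, i.e. the affinity inequality of PalmAffinityBound with C :=
K/2 (index shift n ↦ n+1 under atTop; Bochner ↔ lintegral conversion for continuous nonnegative
integrands on the finite-measure cell). [difficulty: M] [Reatto1969, McMillan1965, Lieb1963]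
#9 PalmAffinityFlatMode (support) — shared verbatim with route BECRieszShadow
(stmt-AtomisticToContinuum-9163): AFFINITY ⇒ FLAT MODE. For L > 0 and a nonnegative periodic trial
state Ψ of n+1 bosons with ∫|Ψ(x,Y)|² dY ≤ e^C ∫|Ψ(x,Y)||Ψ(y,Y)| dY for all x, y:
condensateOccupation ≥ e^{−C}(n+1). [difficulty: provable-now] [PenroseOnsager1956, LSSY2005,
Fournais2020]
#9 PeriodicOccupationStability (support) — shared verbatim with route BECRieszShadow
(stmt-AtomisticToContinuum-9164): OCCUPATION STABILITY on the torus: for periodic trial states Ψ, Φ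
of N bosons and |c| = 1, condensateOccupation(Ψ)^{1/2} ≤ condensateOccupation(Φ)^{1/2} +
N^{1/2}(∫_{cell^N}|Ψ − cΦ|²)^{1/2}. [difficulty: provable-now] [LSSY2005, Fournais2020]
#9 AffinityFrameGlue (support) — shared verbatim with route BECRieszShadow
(stmt-AtomisticToContinuum-9165): FRAME GLUE. PalmAffinityBound → PeriodicRigidity →
PalmAffinityFlatMode → PeriodicOccupationStability → the PeriodicBEC body (∀ admissible v ∃ρ₀ ∀ρ<ρ₀
∃c>0 ∀ᶠN ∃δ>0 ∀ δ-near-minimisers Ψ of the periodic energy, c·N ≤ condensateOccupation); ENNReal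
bookkeeping (c := e^{−C}/4, η := e^{−C}/4 in rigidity). [difficulty: provable-now] [LSSY2005,
PenroseOnsager1956]

TWO-LAYER PLAN. Foreseen glued splits (nothing filed now). (i) AntibunchingGS ⇐ ContactAntibunching
→ ScreenedConditionalEnergy →
AntibunchingGS. The card's engine is the exact identity for the positive eigenfunction, Δ_y P =
e(y)·P(y) on the torus,
e(y) = E[Σ_i|∇_iΨ₀|²/Ψ₀² + V − E₀ | x₁ − x₂ = y] (diagonal, translation-averaged contracted
Schrödinger equation; ∫_cell eP
= 0), but NOT the bare maximum principle: by the sum rule the near field carries ∫_{|y|≲R}eP ≈ 8πa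
(the scattering energy)
and the far field sits at e(∞) = −8πa/L³ < 0, so a superlevel set {P > 1 + C/N} in the far field is
not excluded by sign
alone (the admissible overshoot εL² with ε = 8πa/L³ is a/L ≫ C/N), and inside the screening region a
< r < ξ one has e ≈
−16πρa²/r < 0 anyway. The usable form is the POISSON REPRESENTATION P − 1 = G_T ∗ (eP) (G_T the
zero-mean torus Green's
function), whose near-field source reproduces −2a/|y| and in which anti-bunching becomes
ScreenedConditionalEnergy: the
far-field variation of e screens the Coulomb-like tail at the healing length with the right sign (a
statement about the
conditional energy profile, checkable against Bogoliubov: e = ΔP/P with P − 1 ≈ ρ⁻¹∫(S−1)e^{iky}đk);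
ContactAntibunching
(P ≤ 1 + C/N for |y| ≤ R₁ ≍ ρ^{−1/3}, where e > 0 and the two-body maximum principle of LSSY Lemma
C.2 does lift) is the
easy child. (ii) NonPairwisePalmMean ⇐ ThreeBodyPalmMean → CollectiveRemainder → NonPairwisePalmMean
with u := capped
−log f_v plus the Reatto–Chester tail (the same split BECRieszShadow foresees for PhononDressing;
the two routes should
share the children). (iii) HardCorePalmAffinity ⇐ HardCoreApproximants (C¹ near-minimisers
converging slice-wise to the
Lipschitz Ψ₀) → VoidConditionedJensen → HardCorePalmAffinity. (iv) PeriodicRigidity as in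
BECRieszShadow's plan (iii).

KILL CRITERIA. A published or computed dilute-gas pair function with a statistically significant
overshoot g₂ > 1 + O(1/N) at some
ρa³ → 0 sequence (DMC pure estimators for hard spheres at ρa³ = 10⁻⁴…10⁻², or a Bogoliubov-level
sign change of
ρ⁻¹∫(S−1)e^{iky}đk) refutes AntibunchingGS as stated → close `refuted:AntibunchingGS` unless the
overshoot is O((ρa³)^α)
and bounded, in which case restate rank 2 as BoundedPairExcess (ρ∫(g₂−1)₊ ≤ C, all the glue uses) —
a misstated-class
repair, not a pivot. ¬NonPairwisePalmMean with AntibunchingGS standing (log L drift of the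
non-pairwise Palm mean, e.g.
from PIGS estimates of the mean log-ratio) kills this front AND BECRieszShadow's
TeleportEntropyBound: pivot to
second-moment / affinity currencies (cards swap-affinity-insertion-variance,
chi2-deletion-tolerance) or close
`refuted:NonPairwisePalmMean`. ¬PeriodicRigidity or ¬BoundaryTransferWeak are shared frame failures
(pivot to the
Dirichlet-direct frame of BECPalmLandscape, bec_of_zeroMode proved). PalmAffinityBound proved by
BECRieszShadow's own
front moots ranks 3–4 here but not rank 2 (anti-bunching keeps its stand-alone consumers:
AntibunchingBoundsS for every
sum-rule card, voids for Palm cards). A refutation of a support (AntibunchingPalmGlue,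
AntibunchingBoundsS) can only be a
mis-typing (index shift, Bochner/lintegral junk): restate.

NOT DECOMPOSED YET. The engine of rank 2 (identity Δ_yP = eP needs the C¹ minimiser to be W^{2,p},
true for bounded v; the Poisson
representation and the screening statement need the torus Green's function as a Literature object) —
deliberately not
filed until a grounder confirms the typing of AntibunchingGS; the children of rank 3 (three-body
Palm mean with an
explicit u = capped scattering solution: needs f_v as a function, PeriodicBoseGasScatteringSolution
has the ODE layer);
hard cores (rank 4) beyond the statement; uniqueness of the periodic ground state (not needed: ranks
2–3 quantify over
all positive TI minimisers and PositiveGroundState supplies one); the ∃-near-minimiser (all v) form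
of anti-bunching and
its transfer to all δ-near-minimisers in L¹-hole form via PeriodicRigidity (∫|P_Φ − P_Ψ| ≤
2L³‖Φ−Ψ‖₂; pointwise
anti-bunching does NOT transfer — needles); sub-Poissonian counts Var N_A ≤ ρ|A|(1+2C) and the void
bound as separate
support items (one-line corollaries, file when a consumer asks); positive temperature; d = 2.

CHEAPEST FALSIFIER. (a) Done while planning, by hand: the conditional-energy sum rule ∫eP = 0 with
near-field source 8πa gives e(∞) =
−8πa/L³, which kills the card's bare maximum-principle step (overshoot bound εL² = 8πa/L ≫ C/N) —
recorded; the crux was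
therefore filed as anti-bunching itself, and the Poisson representation reproduces g₂ − 1 ≈ −2a/r
correctly (sanity
check passed). (b) Cheapest external check of rank 2: read off g(r) of hard-sphere bosons at ρa³ =
10⁻⁴, 10⁻³, 10⁻² from
GiorginiBoronatCasulleras1999 (Fig. of g(r); card audit read p.4: monotone hole at low density,
shells only towards
freezing) and IsiharaYee1964's analytic low-density g(r): any overshoot above 1 beyond statistical
error at the two
lowest densities retires AntibunchingGS as stated. (c) Quadrature (minutes, kit): h(r) =
(2π²ρr)⁻¹∫₀^∞ k sin(kr)(S(k)−1)dk
with S = k/√(k²+16πρa) must be < 0 for all r (card: negative at 11 tested radii); a sign change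
refutes the Bogoliubov-level
consistency. (d) Rank 3 sanity: free gas (Ψ₀ = const, Palm mean 0) and the Bijl–Jastrow state with u
= capped a/r (R ≡ const)
are consistent; for the latter rank 2 is a classical-fluid anti-bunching question at plasma
parameter √(ρa³).

NUMBERS. Units ħ = 2m = 1 (LSSY): E₀/N = 4πρa(1 + (128/15√π)√(ρa³) + …); energy per pair 8πa/L³;
conditional energy excess:
∫_{near} eP ≈ 8πa, e(∞) = −8πa/L³; e changes sign at r ≈ (4πρ)^{−1/3} (2a²/r⁴ = a/(rξ²)), ξ =
(8πρa)^{−1/2}. Pair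
function: P = g₂/(1−1/N), cell-mean 1, far field ≈ 1 + 1/N (so C ≥ 1); two-body regime g₂ ≈ f² with
f = 1 − a/r beyond
the range, f nondecreasing, f ≤ 1 (LSSY Lemma C.2, PDF p.152); Bogoliubov S(k) = k/√(k² + 16πρa), g₂
− 1 ≈ −2a/r for a ≪ r
≪ ξ, ≍ −r⁻⁴ beyond. Hole control: ∫_cell|P − 1| ≤ 2L³C/N ⇒ ρ∫|g₂ − 1| ≤ 1 + 2C, S_N(k) ≤ 1 + 2C (k ≠
0), pair part of the
Palm mean ≤ 4U₀C, K = 2C_B + 8U₀C_A, affinity constant C = K/2, condensate fraction ≥ e^{−K/2}/4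
after the frame.
Calibration (palm-kl-sum-rule audit): with u = a/r the pairwise Palm mean is D = (2a/π)∫(1−S)dk =
(8/√π)√(ρa³) = 3× the
Bogoliubov depletion. Items at open: 14 (1 target, 5 cruxes, 7 supports, 1 assembly); 7 of them
shared verbatim with
BECRieszShadow (9157, 9162–9165, 9467, 0827).

DEFINITION REQUESTS. None needed to type the items (PeriodicTrialState, periodicEnergy,
periodicGroundStateEnergy, sideLength, cellN, Config,
Space, condensateOccupation, structureFactorVar, HasGroundStateBEC all exist; the pair density is
inlined as a lintegral
with Matrix.vecCons (X 0 + y) X). For the layer-2 engine of rank 2 a Literature object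
`torusGreenFunction L` (zero-mean
periodic Newtonian kernel, ΔG = δ − L⁻³) and the scattering solution f_v as a function will be
requested when (i) of the
Two-layer plan is filed.

Novelty: Searches (2026-08-15, this seat; searchd FTS leg busy, galaxyd saturated, OpenAlex 429): `lit search
--hybrid "pair
correlation function dilute Bose gas ground state antibunching g(r) less than one"` (10 textbook
hits: Griffin1993,
Griffin–Snoke–Stringari 1995, Lipparini2008, Korepin1993 — no theorem); `lit search --source
crossref "ground state
dilute Bose gas pair correlation function Monte Carlo hard spheres"` (11: IsiharaYee1964
doi:10.1016/0031-8914(64)90041-2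
analytic dilute hard-sphere g(r); Bocchieri–Orzalesi 1964/67 three-body correlation; Wu1959;
GiorginiBoronatCasulleras1999;
Mazzanti–Polls–Fabrocini 2005 hard disks); `--source crossref "Lieb simplified approach …"`
(Lieb1963 parts I–III);
`--source crossref "contracted Schrödinger equation pair density Bose …"` (Mazziotti CSE literature,
plasma BBGKY; no Bose
max-principle use); `--source arxiv "Carlen Jauslin Lieb …"` (0); `lit frontier AtomisticToContinuum
--since 2022` (30
rows: kinetic/Neumann localisation arXiv:2510.20493, arXiv:2603.20776, trial states arXiv:2605.06844
— energy lines
only); `lit galaxy search "pair correlation function dilute Bose gas ground state" --star all`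
(queue saturated, 0);
LSSY2005 App. C re-read (p.152, Lemma C.2: f₀ nondecreasing). In-tree: 132 cards of the sub
(ideas.json) and the 16 open
route files: anti-bunching / g₂ ≤ 1 / an a-priori bound on S is a crux nowhere; BECRieszShadow's
plan (ii) needs sup g₂
< ∞ as an unfiled input; card audits 32/33 (Cohen–Frishberg/Nakatsuji CSE  [refs: 10.1016/0031-8914(64, 2510.20493, 2603.20776, 2605.06844, doi:10.1016/0031-8914, Griffin1993, IsiharaYee1964, GiorginiBoronatCasulleras1999, Lieb1963, LSSY2005, CarlenJauslinLieb2021, Reatto1969]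

Barriers (technique_class: antibunching, palm-jensen, positivity, sum-rules): - technique_class: antibunching, palm-jensen, positivity, sum-rules
- Literature.Barriers.AtomisticToContinuum.KineticGapLengthScales: evaded — no kinetic gap, Poincaré
inequality or energy localisation at any scale; δ is chosen after N and used only for L²-rigidity at
fixed N inside the shared frame; the constant is e^{−O(1)}/4, not 1 − o(1).
- Literature.Barriers.AtomisticToContinuum.KineticGapLengthScalesNarrow: outside the energy-window
class — ranks 2–3 are properties of the exact positive ground state (pair-density sign, Palm mean),
false for generic states in any energy window (needles), exactly the inputs the audit lists as not
covered.
- Literature.Barriers.AtomisticToContinuum.EnergyAsymptoticsWithoutCondensation: evaded — no energy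
asymptotics is matched at any order; the only energy quantity appearing (e(y), in the layer-2
engine) is a conditional DIFFERENCE whose profile, not the value of E₀, is used.
- Literature.Barriers.AtomisticToContinuum.EnergyAsymptoticsWithoutCondensationNarrow: same; the
Lieb–Liniger witness is d = 1, where anti-bunching holds (Tonks: g₂ = 1 − (sin πρr/πρr)² ≤ 1) but
the Palm mean with the L-dependent 1-D kernel grows like log L, so the chain correctly returns no
BEC.
- Literature.Barriers.AtomisticToContinuum.BogoliubovPerturbationInfrared: not met by the items (no
expansion around the Bogoliubov state; all statements are about |Ψ₀|² and its Palm laws,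
gauge-invariant); conceded that a perturbative ENGINE for ScreenedConditionalEnergy o

History (route lifecycle, newest last):
- 2026-08-25T00:51:17Z · DORMANT — reconciler: no traction for 7.2 d (last activity item-evidence-added at 2026-08-17T18:55:01Z); parked, not closed — `ledger route dormant route-AtomisticToConti (operator:999:1251455)
- 2026-08-29T03:23:10Z · REACTIVATED — reconciler: reactivated — activity statement-checked at 2026-08-29T01:17:37Z after parking at 2026-08-25T00:51:17Z (operator:999:4152048)
- 2026-08-29T19:24:07Z · DORMANT — census g0: costume|duplicate of route-AtomisticToContinuum-BECRieszShadow; reader census-reader-32-g0 (operator:999:677811)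
- 2026-08-29T21:05:12Z · REACTIVATED — census: dormancy REVERTED — g1 reader + census-trib-costume-C class it NOT-COSTUME (21-frontier 20:08:25Z: no single-read elimination) (operator:999:1910282)

sub-problem: BoseEinsteinCondensation · status: open · opened planner-plancard-AtomisticToContinuum-BoseEin-10c66410-0 2026-08-15T15:45:48Z · rev 4 · ledger route-AtomisticToContinuum-BECLiebAntibunching
GENERATED by the gate from the ledger (D-0016/17). Provers cite these decls: `theorem foo : Summit.AtomisticToContinuum.BoseEinsteinCondensation.Theses.BECLiebAntibunching.<Decl> := …` in Summits/AtomisticToContinuum/BoseEinsteinCondensation/Theorems/<Name>.lean.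
-/

namespace Summit.AtomisticToContinuum.BoseEinsteinCondensation.Theses.BECLiebAntibunching

open scoped BigOperators Topology Manifold Classical MeasureTheory ProbabilityTheory Matrix InnerProductSpace ComplexConjugate ContinuousMap
open Filter Set Function TopologicalSpace MeasureTheory

attribute [summit_statement] _root_.BoseEinsteinCondensation

/-- item stmt-AtomisticToContinuum-9157 · target · rank 0 · open · by planner
why it might fail: Uniform-in-separation ODLRO γ(x,y) ≥ e^(−C)γ(x,x) for positive near-ground states is BEC-strength on every subclass (open, LSSY §1.2/Ch.5): needs control at all r ≤ L√3/2; an unscreened collective tail of −log Ψ₀ would leave only γ ≥ ρN^(−ε); hard cores enter only via 10241.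
sources: Reatto1969, PenroseOnsager1956, LSSY2005 §1.2 (1.19), Ch.5 p.35, ReattoChester1967
[target] X as in § Thesis: for every admissible v, ρ < ρ₀(v), some C, eventually in N = n+1, for
every δ > 0 a nonnegative periodic δ-near-minimiser Ψ with ∫_(cell^n)|Ψ(x,Y)|² dY ≤ e^C
∫_(cell^n)|Ψ(x,Y)||Ψ(y,Y)| dY for all x, y ∈ ℝ³ (card item: Palm–Jensen assembly; the true gas at η
= ξ predicts C ≈ (4/√π)√(ρa³)). -/
@[route_item "route-AtomisticToContinuum-BECLiebAntibunching"]
def PalmAffinityBound : Prop :=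
  ∀ v : ℝ → ENNReal, Literature.MathematicalPhysics.QuantumManyBody.BoseGas.IsRepulsiveFiniteRange v → ∃ ρ₀ : ℝ, 0 < ρ₀ ∧ ∀ ρ : ℝ, 0 < ρ → ρ < ρ₀ → ∃ C : ℝ, ∀ᶠ n : ℕ in Filter.atTop, ∀ δ : ENNReal, 0 < δ → ∃ Ψ : Literature.MathematicalPhysics.QuantumManyBody.BoseGas.PeriodicTrialState (n + 1) (Literature.MathematicalPhysics.QuantumManyBody.BoseGas.sideLength ρ (n + 1)), Literature.MathematicalPhysics.QuantumManyBody.BoseGas.periodicEnergy v Ψ ≤ Literature.MathematicalPhysics.QuantumManyBody.BoseGas.periodicGroundStateEnergy v (n + 1) (Literature.MathematicalPhysics.QuantumManyBody.BoseGas.sideLength ρ (n + 1)) + δ ∧ (∀ X, Ψ.ψ X = (‖Ψ.ψ X‖ : ℂ)) ∧ ∀ x y : Literature.MathematicalPhysics.QuantumManyBody.BoseGas.Space, ∫⁻ Y in Literature.MathematicalPhysics.QuantumManyBody.BoseGas.cellN n (Literature.MathematicalPhysics.QuantumManyBody.BoseGas.sideLength ρ (n + 1)), (‖Ψ.ψ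 (Matrix.vecCons x Y)‖₊ : ENNReal) ^ 2 ≤ ENNReal.ofReal (Real.exp C) * ∫⁻ Y in Literature.MathematicalPhysics.QuantumManyBody.BoseGas.cellN n (Literature.MathematicalPhysics.QuantumManyBody.BoseGas.sideLength ρ (n + 1)), (‖Ψ.ψ (Matrix.vecCons x Y)‖₊ : ENNReal) * (‖Ψ.ψ (Matrix.vecCons y Y)‖₊ : ENNReal)

/-- item stmt-AtomisticToContinuum-10239 · crux · rank 2 · open · by planner
why it might fail: Asserts g₂ ≤ 1+C/N at EVERY r as ρ→0, but bunching IS seen at intermediate density (QMC and Big eq.: C₂/ρ² ≈ 1.2 at ρ=0.02 for v=16e^(−|x|), Jauslin2022 Fig 4.3), so ρ₀(v) is load-bearing; at r~ξ the sign is an O(√(ρa³)) competition (−2a/r vs LHY local terms); no exact estimate on g₂ is in print.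
sources: Lieb1963, CarlenJauslinLieb2021, Jauslin2022 §4.5 p.15 + Fig 4.3 (doi:10.4171/90-1/25, held, read), CarlenEtAl2021 Fig 5 (doi:10.1103/physreva.103.053309), LSSY2005 App. C Lemma C.2, doi:10.1103/PhysRev.106.1135
[crux] ANTI-BUNCHING OF THE DILUTE GROUND STATE (card K1+K2 fused into their conclusion; Lieb's g ≤
1 in finite-N form). For every repulsive finite-range v that is bounded (v ≤ M < ∞) there is ρ₀ > 0
such that for 0 < ρ < ρ₀ there is C with, for all large N = n+2 and L = (N/ρ)^{1/3}: every positive,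
translation-invariant periodic trial state attaining the periodic ground-state energy (the ground
state Ψ₀; it exists and is unique up to phase, PositiveGroundState) has translation-averaged Born
pair density P(y) = L³∫_{cell^{n+1}}|Ψ₀(x₂+y, x₂, x₃, …)|² dX ≤ 1 + C/N for EVERY y ∈ ℝ³ (P has
cell-mean 1, P ≡ 1 for the free gas, g₂ = (1−1/N)P; the canonical far field is P ≈ 1 + 1/N, so C ≥ 1
is expected; Bogoliubov: g₂ − 1 = ρ⁻¹∫(S−1)e^{iky}đk < 0 at every r with S = k/√(k²+16πρa), checked
numerically on the card; dilute hard spheres: IsiharaYee1964, DMC GiorginiBoronatCasulleras1999).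
Consequences filed as support: S_N(k) ≤ 1+2C (AntibunchingBoundsS); voids P_x(B_a(y) occupied) ≤
(4π/3)ρa³(1+C/N). [deps: PositiveGroundState] [difficulty: open-problem] -/
@[route_item "route-AtomisticToContinuum-BECLiebAntibunching", crux]
def AntibunchingGS : Prop :=
  open Literature.MathematicalPhysics.QuantumManyBody.BoseGas in ∀ v : ℝ → ENNReal, IsRepulsiveFiniteRange v → (∃ M : NNReal, ∀ r, v r ≤ M) → ∃ ρ₀ : ℝ, 0 < ρ₀ ∧ ∀ ρ : ℝ, 0 < ρ → ρ < ρ₀ → ∃ C : ℝ, ∀ᶠ n : ℕ in Filter.atTop, ∀ Ψ : PeriodicTrialState (n + 2) (sideLength ρ (n + 2)), periodicEnergy v Ψ = periodicGroundStateEnergy v (n + 2) (sideLength ρ (n + 2)) → (∀ X, 0 < (Ψ.ψ X).re ∧ (Ψ.ψ X).im = 0) → (∀ (X : Config (n + 2)) (t : Space), Ψ.ψ (fun i => X i + t) = Ψ.ψ X) → ∀ y : Space, ENNReal.ofReal (sideLength ρ (n + 2) ^ 3) * ∫⁻ X in cellN (n + 1) (sideLength ρ (n + 2)), (‖Ψ.ψ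 (Matrix.vecCons (X 0 + y) X)‖₊ : ENNReal) ^ 2 ≤ ENNReal.ofReal (1 + C / (n + 2))

/-- item stmt-AtomisticToContinuum-10240 · crux · rank 3 · open · by planner
why it might fail: Needs ½KL(p_x‖p_y) = O(1) uniformly in N once the pair part is freed (given rank 2 it is ≡ ½·TeleportEntropyBound 9158, open): Gaussian phonons give a convergent ∫d³k/k in d=3 (log L in d=1), so beyond-Gaussian 3-body/backflow terms (u₃ ≍ (r₁r₂)⁻²) must not drift like log L; unprinted either way.
sources: Reatto1969, ReattoChester1967, McMillan1965, CarlenJauslinLieb2020, GavoretNozieres1964, stmt-AtomisticToContinuum-9158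
[crux] PALM MEAN OF THE NON-PAIRWISE LANDSCAPE (card palm-kl-sum-rule K1, typed with a FREE BOUNDED
profile). For every bounded repulsive finite-range v there is ρ₀ such that for 0 < ρ < ρ₀ there are
U₀, C with, for all large N = n+2, a continuous, bounded (|u| ≤ U₀), even, Lℤ³-periodic u : ℝ³ → ℝ
such that every positive translation-invariant periodic ground state Ψ₀ (as in AntibunchingGS)
satisfies, for all x, y ∈ ℝ³: ∫_{cell^{n+1}} Ψ₀(x,Y)² [log(Ψ₀(x,Y)/Ψ₀(y,Y)) − Σ_j (u(y−Y_j) −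
u(x−Y_j))] dY ≤ C ∫_{cell^{n+1}} Ψ₀(x,Y)² dY, i.e. E_{P_x}[R(y,·) − R(x,·)] ≤ C for R = −log Ψ₀ −
Σ_j u(·−Y_j) (the pairwise u–u terms among the bath cancel in the difference). u is meant to absorb
the whole two-body structure of log Ψ₀ (capped scattering solution −log f, Reatto–Chester 1/r² tail,
any bounded profile): given AntibunchingGS its Palm mean is free, so only ≥3-body / collective
structure is at stake; with u ≡ 0 the item is ½·TeleportEntropyBound of BECRieszShadow (stmt-9158),
hence weaker than it. [deps: AntibunchingGS] [difficulty: open-problem] -/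
@[route_item "route-AtomisticToContinuum-BECLiebAntibunching", crux]
def NonPairwisePalmMean : Prop :=
  open Literature.MathematicalPhysics.QuantumManyBody.BoseGas in ∀ v : ℝ → ENNReal, IsRepulsiveFiniteRange v → (∃ M : NNReal, ∀ r, v r ≤ M) → ∃ ρ₀ : ℝ, 0 < ρ₀ ∧ ∀ ρ : ℝ, 0 < ρ → ρ < ρ₀ → ∃ U₀ C : ℝ, ∀ᶠ n : ℕ in Filter.atTop, ∃ u : Space → ℝ, Continuous u ∧ (∀ z, |u z| ≤ U₀) ∧ (∀ z, u (-z) = u z) ∧ (∀ (z : Space) (k : Fin 3), u (z + EuclideanSpace.single k (sideLength ρ (n + 2))) = u z) ∧ ∀ Ψ : PeriodicTrialState (n + 2) (sideLength ρ (n + 2)), periodicEnergy v Ψ = periodicGroundStateEnergy v (n + 2) (sideLength ρ (n + 2)) → (∀ X, 0 < (Ψ.ψ X).re ∧ (Ψ.ψ X).im = 0) → (∀ (X : Config (n + 2)) (t : Space), Ψ.ψ (fun i => X i + t) = Ψ.ψ X) → ∀ x y : Space, ∫ Y in cellN (n + 1) (sideLength ρ (n + 2)), ‖Ψ.ψ (Matrix.vecCons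 x Y)‖ ^ 2 * (Real.log (‖Ψ.ψ (Matrix.vecCons x Y)‖ / ‖Ψ.ψ (Matrix.vecCons y Y)‖) - ∑ j : Fin (n + 1), (u (y - Y j) - u (x - Y j))) ≤ C * ∫ Y in cellN (n + 1) (sideLength ρ (n + 2)), ‖Ψ.ψ (Matrix.vecCons x Y)‖ ^ 2

/-- item stmt-AtomisticToContinuum-10241 · crux · rank 4 · open · by planner
why it might fail: = target PalmAffinityBound verbatim on the unbounded subclass (hard spheres): uniform ODLRO of positive near-ground states is BEC-strength (open, LSSY Ch.5); no engine here (positivity identities need exact C¹ minimisers, Ψ₀ is Lipschitz at contact); C must be uniform over C¹ approximants in x,y,N.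
sources: LSSY2005 §1.2 p.8, Ch.5 p.35, PenroseOnsager1956, Reatto1969, KalosLevesqueVerlet1974, GiorginiBoronatCasulleras1999
[crux] HARD-CORE PALM AFFINITY: the body of PalmAffinityBound for the members of the class that are
NOT bounded (v taking the value ⊤ or unbounded finite values: hard spheres, hard core plus tail).
Filed as a crux because the positivity engine above is typed on exact C¹ ground states, which do not
exist for hard cores (Ψ₀ is Lipschitz at contact): the ∃-witness must be a C¹ near-minimiser
approximating Ψ₀, with the event-conditioned Jensen γ(x,y)/ρ ≥ P_x(A_y)·exp(−E[Δ | A_y]), P_x(A_y) ≥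
1 − (4π/3)ρa³ sup g₂ (anti-bunching of the approximant supplies the void bound). [deps:
AntibunchingGS, NonPairwisePalmMean] [difficulty: open-problem] -/
@[route_item "route-AtomisticToContinuum-BECLiebAntibunching", crux]
def HardCorePalmAffinity : Prop :=
  ∀ v : ℝ → ENNReal, Literature.MathematicalPhysics.QuantumManyBody.BoseGas.IsRepulsiveFiniteRange v → (¬ ∃ M : NNReal, ∀ r, v r ≤ M) → ∃ ρ₀ : ℝ, 0 < ρ₀ ∧ ∀ ρ : ℝ, 0 < ρ → ρ < ρ₀ → ∃ C : ℝ, ∀ᶠ n : ℕ in Filter.atTop, ∀ δ : ENNReal, 0 < δ → ∃ Ψ : Literature.MathematicalPhysics.QuantumManyBody.BoseGas.PeriodicTrialState (n + 1) (Literature.MathematicalPhysics.QuantumManyBody.BoseGas.sideLength ρ (n + 1)), Literature.MathematicalPhysics.QuantumManyBody.BoseGas.periodicEnergy v Ψ ≤ Literature.MathematicalPhysics.QuantumManyBody.BoseGas.periodicGroundStateEnergy v (n + 1) (Literature.MathematicalPhysics.QuantumManyBody.BoseGas.sideLength ρ (n + 1)) + δ ∧ (∀ X, Ψ.ψ X =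 (‖Ψ.ψ X‖ : ℂ)) ∧ ∀ x y : Literature.MathematicalPhysics.QuantumManyBody.BoseGas.Space, ∫⁻ Y in Literature.MathematicalPhysics.QuantumManyBody.BoseGas.cellN n (Literature.MathematicalPhysics.QuantumManyBody.BoseGas.sideLength ρ (n + 1)), (‖Ψ.ψ (Matrix.vecCons x Y)‖₊ : ENNReal) ^ 2 ≤ ENNReal.ofReal (Real.exp C) * ∫⁻ Y in Literature.MathematicalPhysics.QuantumManyBody.BoseGas.cellN n (Literature.MathematicalPhysics.QuantumManyBody.BoseGas.sideLength ρ (n + 1)), (‖Ψ.ψ (Matrix.vecCons x Y)‖₊ : ENNReal) * (‖Ψ.ψ (Matrix.vecCons y Y)‖₊ : ENNReal)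

/-- item stmt-AtomisticToContinuum-0827 · crux · rank 5 · open · by planner
why it might fail: PeriodicBEC(v) constrains only δ-near-minimisers of the PERIODIC energy (δ after N): the Dirichlet GS lies a wall energy ≫ δ above E₀^per, interior restrictions are neither periodic nor sharp-N, so it never fires; only the ENERGY transfer is printed, Neumann bracketing + mode-free step unwritten.
sources: LiebSeiringerSolovejYngvason2005 Ch.2 after (2.2)/(2.8); Thm 5.1 remark p.36, Literature.MathematicalPhysics.QuantumManyBody.BoseGas.LSSY2005_e0_periodic_eq_dirichlet_offCritical_holds (energy analogue, in tree, proved), Basti2022, BoccatoSeiringer2023, Junge2026 Thm 3, LauwersVerbeureZagrebnov2003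
[crux] BoundaryTransferWeak (mode-free boundary-condition transfer, per potential): for each
repulsive finite-range v, PeriodicBEC(v) implies ∃ρ₀>0 ∀ρ∈(0,ρ₀) HasGroundStateBEC v ρ (Dirichlet
ground state, λ_max(γ) ≥ cN via condensateNumber). Not glue: near-minimiser slacks are O(N/L²) while
Dirichlet/periodic energies differ by a boundary term ≫ N/L², so no energy-comparison proof;
expected route: Neumann bracketing of interior sub-boxes (−Δ_Dir ≥ ⊕−Δ_Neu, v ≥ 0) + a mode-free
criterion (λ_max ≥ tr γ²/N). Only the ENERGY analogue is in print (LiebSeiringerSolovejYngvason2005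
Ch. 2 after (2.8)). v ≡ 0: hypothesis and conclusion both true. -/
@[route_item "route-AtomisticToContinuum-BECLiebAntibunching", crux]
def BoundaryTransferWeak : Prop :=
  ∀ v : ℝ → ENNReal, Literature.MathematicalPhysics.QuantumManyBody.BoseGas.IsRepulsiveFiniteRange v → (∃ ρ₀ : ℝ, 0 < ρ₀ ∧ ∀ ρ : ℝ, 0 < ρ → ρ < ρ₀ → ∃ c : ℝ, 0 < c ∧ ∀ᶠ N : ℕ in Filter.atTop, ∃ δ : ENNReal, 0 < δ ∧ ∀ Ψ : Literature.MathematicalPhysics.QuantumManyBody.BoseGas.PeriodicTrialState N (Literature.MathematicalPhysics.QuantumManyBody.BoseGas.sideLength ρ N), Literature.MathematicalPhysics.QuantumManyBody.BoseGas.periodicEnergy v Ψ ≤ Literature.MathematicalPhysics.QuantumManyBody.BoseGas.periodicGroundStateEnergy v N (Literature.MathematicalPhysics.QuantumManyBody.BoseGas.sideLength ρ N) + δ → ENNReal.ofReal (c * N) ≤ Literature.MathematicalPhysics.QuantumManyBody.BoseGas.condensateOccupation N (Literature.MathematicalPhysics.QuantumManyBody.BoseGas.sideLength ρ N) Ψ.ψ)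 → ∃ ρ₀ : ℝ, 0 < ρ₀ ∧ ∀ ρ : ℝ, 0 < ρ → ρ < ρ₀ → Literature.MathematicalPhysics.QuantumManyBody.BoseGas.HasGroundStateBEC v ρ

/-- item stmt-AtomisticToContinuum-9467 · crux · rank 6 · open · by planner
why it might fail: Bounded v: known (RS XIII.47 + compact resolvent ⇒ simple GS + gap at fixed N). ⊤-valued admissible v (hard cores, hollow shells ⊤·1_[r₁,r₂]) disconnect the finite-energy config space, RS XIII.48(b) allows degeneracy: the dilute component must be uniquely minimal and connected for all N; unprinted.
sources: ReedSimonIV1978 Thm XIII.47, XIII.48, doi:10.1215/s0012-7094-75-04251-9, Davies1989 Prop 1.4.3, BaryshnikovBubenikKahle2013, LSSY2005 Ch.2, Fournais2020 (1.1)–(1.2)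
[crux] PERIODIC RIGIDITY (torus ground-state rigidity; weakened η-first form, re-filed as a LISTED
item of route BECRieszShadow because the identical ∀ᶠN-first statement
stmt-AtomisticToContinuum-6516 was closed moot with the retired routes): for every admissible v, ρ <
ρ₀(v), every η > 0, eventually in N, there is δ > 0 such that any two δ-near-minimisers Ψ, Φ of the
periodic energy (L = (N/ρ)^(1/3)) satisfy ∫_(cell^N)|Ψ − cΦ|² ≤ η for some unit complex c (E₀^per <
∞, compact resolvent, unique positive ground state and a spectral gap at fixed N; hard cores via
low-density connectivity of the torus hard-sphere configuration space). This is exactly what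
AffinityFrameGlue consumes (η := e^(−C)/4 is fixed before N). Why it might fail: v = ⊤ walls (hard
cores, hollow impenetrable shells ⊤·1_[r₁,r₂]) disconnect the fixed-N configuration space;
uniqueness then needs every non-dilute component (jammed or bound clusters) to lie an N-uniform gap
above E₀^per, and E₀^per = ⊤ would make the item vacuous-false. Sources: ReedSimonIV1978
XIII.12/XIII.47; BaryshnikovBubenikKahle2013 = doi:10.1093/imrn/rnt012; LSSY2005 Ch. 2; Fournais2020
(1.1)–(1.2). [difficulty: M] -/
@[route_item "route-AtomisticToContinuum-BECLiebAntibunching", crux]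
def PeriodicRigidity : Prop :=
  ∀ v : ℝ → ENNReal, Literature.MathematicalPhysics.QuantumManyBody.BoseGas.IsRepulsiveFiniteRange v → ∃ ρ₀ : ℝ, 0 < ρ₀ ∧ ∀ ρ : ℝ, 0 < ρ → ρ < ρ₀ → ∀ η : ℝ, 0 < η → ∀ᶠ N : ℕ in Filter.atTop, ∃ δ : ENNReal, 0 < δ ∧ ∀ Ψ Φ : Literature.MathematicalPhysics.QuantumManyBody.BoseGas.PeriodicTrialState N (Literature.MathematicalPhysics.QuantumManyBody.BoseGas.sideLength ρ N), Literature.MathematicalPhysics.QuantumManyBody.BoseGas.periodicEnergy v Ψ ≤ Literature.MathematicalPhysics.QuantumManyBody.BoseGas.periodicGroundStateEnergy v N (Literature.MathematicalPhysics.QuantumManyBody.BoseGas.sideLength ρ N) + δ → Literature.MathematicalPhysics.QuantumManyBody.BoseGas.periodicEnergy v Φ ≤ Literature.MathematicalPhysics.QuantumManyBody.BoseGas.periodicGroundStateEnergy v N (Literature.MathematicalPhysics.QuantumManyBody.BoseGas.sideLength ρ N) + δ → ∃ c : ℂ, ‖c‖ = 1 ∧ ∫⁻ X in Literature.MathematicalPhysics.QuantumManyBody.BoseGas.cellN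 N (Literature.MathematicalPhysics.QuantumManyBody.BoseGas.sideLength ρ N), (‖Ψ.ψ X - c * Φ.ψ X‖₊ : ENNReal) ^ 2 ≤ ENNReal.ofReal η

/-- item stmt-AtomisticToContinuum-10242 · support · rank 9 · open · by planner
sources: ReedSimonIV1978, GilbargTrudinger2001, Fournais2020
[support] KNOWN RESULT (existence, positivity, regularity, translation invariance of the periodic
ground state for bounded potentials): for every bounded repulsive finite-range v, every N ≥ 1 and L
> 0 there is a periodic C¹ trial state attaining periodicGroundStateEnergy v N L which is strictly
positive and invariant under simultaneous translation of all particles (H = −ΣΔ_i + Σ v^per(x_i−x_j)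
on the flat torus with V ∈ L^∞: compact resolvent, the form infimum over the C¹ core equals inf spec
and is attained by the eigenfunction, which is W^{2,p} for all p hence C^{1,α}; Perron–Frobenius /
Harnack give uniqueness and strict positivity, and uniqueness plus translation invariance of H give
invariance of Ψ₀). Supplies the object AntibunchingGS and NonPairwisePalmMean quantify over.
[difficulty: L] -/
@[route_item "route-AtomisticToContinuum-BECLiebAntibunching", crux]
def PositiveGroundState : Prop :=
  open Literature.MathematicalPhysics.QuantumManyBody.BoseGas in ∀ v : ℝ → ENNReal, IsRepulsiveFiniteRange v → (∃ M : NNReal, ∀ r, v r ≤ M) → ∀ (N : ℕ) (L : ℝ), 0 < N → 0 < L → ∃ Ψ : PeriodicTrialState N L, periodicEnergy v Ψ = periodicGroundStateEnergy v N L ∧ (∀ X, 0 < (Ψ.ψ X).re ∧ (Ψ.ψ X).im = 0) ∧ (∀ (X : Config N) (t : Space), Ψ.ψ (fun i => X i + t) = Ψ.ψ X)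

/-- item stmt-AtomisticToContinuum-10243 · support · rank 9 · open · by planner
sources: Stringari1995, Lieb1963, IsiharaYee1964
[support] ANTI-BUNCHING BOUNDS THE STRUCTURE FACTOR (provable now; the stand-alone deliverable "S ≤
2" of the card in finite-N form). For L > 0, C ≥ 0, any n and any periodic trial state Ψ of n+2
bosons with L³∫_{cell^{n+1}}|Ψ((X₀+y)::X)|² dX ≤ 1 + C/(n+2) for all y: N·S_N(k) =
structureFactorVar ≤ (1+2C)·N for every k = 2πm/L, m ≠ 0. Proof: N S_N(k) = Var ρ̂_k ≤ E|ρ̂_k|² = N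
+ N(N−1)·L⁻³∫_cell cos(k·y)P(y)dy (Bose symmetry; Tonelli along x₁ = x₂ + y using periodicity in
particle 1), ∫_cell cos(k·y)dy = 0 for m ≠ 0, and ∫_cell|P−1| ≤ 2L³C/N. [difficulty: provable-now] -/
@[route_item "route-AtomisticToContinuum-BECLiebAntibunching"]
def AntibunchingBoundsS : Prop :=
  open Literature.MathematicalPhysics.QuantumManyBody.BoseGas in ∀ (n : ℕ) (L C : ℝ), 0 < L → 0 ≤ C → ∀ Ψ : PeriodicTrialState (n + 2) L, (∀ y : Space, ENNReal.ofReal (L ^ 3) * ∫⁻ X in cellN (n + 1) L, (‖Ψ.ψ (Matrix.vecCons (X 0 + y) X)‖₊ : ENNReal) ^ 2 ≤ ENNReal.ofReal (1 + C / (n + 2))) → ∀ m : Fin 3 → ℤ, m ≠ 0 → structureFactorVar (n + 2) L ((cellN (n + 2) L).indicator Ψ.ψ) m ≤ ENNReal.ofReal ((1 + 2 * C) * (n + 2))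

/-- item stmt-AtomisticToContinuum-10244 · support · rank 9 · open · by planner
sources: Reatto1969, McMillan1965, Lieb1963
[support] THE NEW GLUE (provable now; the route's elementary observation). AntibunchingGS →
NonPairwisePalmMean → PositiveGroundState → HardCorePalmAffinity → PalmAffinityBound, using the
support PalmJensen (stmt-9162, provable now) as a lemma. Proof: fix v; if v is unbounded,
HardCorePalmAffinity is the claim. If v is bounded: ρ₀ := min(ρ₀^A, ρ₀^B); for ρ < ρ₀ take C_A, (U₀,
C_B) and, eventually in n, the profile u and the witness Ψ₀ of PositiveGroundState at (n+2, L); Ψ₀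
is an exact minimiser, hence a δ-near-minimiser for every δ > 0, and real positive, hence Ψ.ψ =
‖Ψ.ψ‖. Translation invariance plus periodicity give x-independent slice mass m_x =
∫_{cell^{n+1}}Ψ₀(x,Y)² dY = L⁻³ and q_x(z) := ∫_{cell^n}Ψ₀(x,z,Y′)² dY′ = P(x−z)/L⁶. Bose symmetry
in Y and the EXACT CANCELLATION ∫_cell[u(y−z) − u(x−z)]dz = 0 (u periodic) give ∫Ψ₀(x,Y)²
Σ_j[u(y−Y_j) − u(x−Y_j)] dY = (n+1)L⁻⁶∫_cell[u(y−z)−u(x−z)](P(x−z)−1)dz ≤ (n+1)L⁻⁶·2U₀·∫_cell|P−1| ≤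
(n+1)L⁻⁶·2U₀·2L³max(C_A,0)/(n+2) ≤ 4U₀max(C_A,0)·m_x (anti-bunching: ∫_cell(P−1)₊ ≤ L³max(C_A,0)/N
and ∫_cell(P−1) = 0). Hence ∫Ψ₀(x,Y)² log(Ψ₀(x,Y)²/Ψ₀(y,Y)²) dY ≤ K·m_x with K := 2C_B +
8U₀max(C_A,0); PalmJensen (continuous, strictly positive, equal s -/
@[route_item "route-AtomisticToContinuum-BECLiebAntibunching", crux]
def AntibunchingPalmGlue : Prop :=
  AntibunchingGS → NonPairwisePalmMean → PositiveGroundState → HardCorePalmAffinity → PalmAffinityBound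

/-- item stmt-AtomisticToContinuum-9162 · support · rank 9 · open · by planner
sources: Reatto1969, McMillan1965, PenroseOnsager1956
[support] PALM–JENSEN. For a continuous strictly positive ψ on (n+1)-configurations with
x-independent slice mass Z = ∫_(cell^n) ψ(x,Y)² dY: if ∫ψ(x,Y)² log(ψ(x,Y)²/ψ(y,Y)²) dY ≤ K·Z for
all x, y then e^(−K/2) Z ≤ ∫ψ(x,Y)ψ(y,Y) dY (Jensen for exp under p_x = ψ(x,·)²/Z: E[√(p_y/p_x)] ≥
exp(−½KL(p_x‖p_y))). [difficulty: provable-now] -/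
@[route_item "route-AtomisticToContinuum-BECLiebAntibunching"]
def PalmJensen : Prop :=
  ∀ (n : ℕ) (L K : ℝ) (ψ : Literature.MathematicalPhysics.QuantumManyBody.BoseGas.Config (n + 1) → ℝ), 0 < L → Continuous ψ → (∀ X, 0 < ψ X) → (∀ x y : Literature.MathematicalPhysics.QuantumManyBody.BoseGas.Space, ∫ Y in Literature.MathematicalPhysics.QuantumManyBody.BoseGas.cellN n L, ψ (Matrix.vecCons x Y) ^ 2 = ∫ Y in Literature.MathematicalPhysics.QuantumManyBody.BoseGas.cellN n L, ψ (Matrix.vecCons y Y) ^ 2) → (∀ x y : Literature.MathematicalPhysics.QuantumManyBody.BoseGas.Space, ∫ Y in Literature.MathematicalPhysics.QuantumManyBody.BoseGas.cellN n L, ψ (Matrix.vecCons x Y) ^ 2 * Real.log (ψ (Matrix.vecCons x Y) ^ 2 / ψ (Matrix.vecCons y Y) ^ 2) ≤ K * ∫ Y in Literature.MathematicalPhysics.QuantumManyBody.BoseGas.cellN n L, ψ (Matrix.vecCons x Y) ^ 2) → ∀ x y : Literature.MathematicalPhysics.QuantumManyBody.BoseGas.Space, Real.exp (-(K / 2)) *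 ∫ Y in Literature.MathematicalPhysics.QuantumManyBody.BoseGas.cellN n L, ψ (Matrix.vecCons x Y) ^ 2 ≤ ∫ Y in Literature.MathematicalPhysics.QuantumManyBody.BoseGas.cellN n L, ψ (Matrix.vecCons x Y) * ψ (Matrix.vecCons y Y)

/-- item stmt-AtomisticToContinuum-9163 · support · rank 9 · open · by planner
sources: PenroseOnsager1956, LSSY2005, Fournais2020
[support] AFFINITY ⇒ FLAT MODE. For L > 0 and a nonnegative periodic trial state Ψ of n+1 bosons
with ∫|Ψ(x,Y)|² dY ≤ e^C ∫|Ψ(x,Y)||Ψ(y,Y)| dY for all x, y: condensateOccupation ≥ e^(−C)(n+1) (n₀ =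
(n+1)L⁻³∫_cell∫_cell∫_(cell^n) Ψ(x,Y)Ψ(y,Y); Fubini for x::Y through the cell indicators of
condensateOccupation; ∫_cell∫_(cell^n)|Ψ(x,Y)|² = 1). [difficulty: provable-now] -/
@[route_item "route-AtomisticToContinuum-BECLiebAntibunching", crux]
def PalmAffinityFlatMode : Prop :=
  ∀ (n : ℕ) (L C : ℝ), 0 < L → ∀ Ψ : Literature.MathematicalPhysics.QuantumManyBody.BoseGas.PeriodicTrialState (n + 1) L, (∀ X, Ψ.ψ X = (‖Ψ.ψ X‖ : ℂ)) → (∀ x y : Literature.MathematicalPhysics.QuantumManyBody.BoseGas.Space, ∫⁻ Y in Literature.MathematicalPhysics.QuantumManyBody.BoseGas.cellN n L, (‖Ψ.ψ (Matrix.vecCons x Y)‖₊ : ENNReal) ^ 2 ≤ ENNReal.ofReal (Real.exp C) * ∫⁻ Y in Literature.MathematicalPhysics.QuantumManyBody.BoseGas.cellN n L, (‖Ψ.ψ (Matrix.vecCons x Y)‖₊ : ENNReal) * (‖Ψ.ψ (Matrix.vecCons y Y)‖₊ : ENNReal)) → ENNReal.ofReal (Real.exp (-C) * (n + 1)) ≤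 Literature.MathematicalPhysics.QuantumManyBody.BoseGas.condensateOccupation (n + 1) L Ψ.ψ

/-- item stmt-AtomisticToContinuum-9164 · support · rank 9 · closed · proved by Summit.AtomisticToContinuum.BoseEinsteinCondensation.Theorems.periodicOccupationStability_proof (prover) · by planner
sources: LSSY2005, Fournais2020
[support] OCCUPATION STABILITY on the torus: for periodic trial states Ψ, Φ of N bosons and |c| = 1,
condensateOccupation(Ψ)^(1/2) ≤ condensateOccupation(Φ)^(1/2) + N^(1/2) (∫_(cell^N)|Ψ − cΦ|²)^(1/2)
(F_Ψ(Y) = ⟨φ₀, Ψ(·,Y)1_cell⟩, |F_Ψ − F_(cΦ)| ≤ ‖(Ψ − cΦ)(·,Y)‖_(L²(cell)), Minkowski in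
L²(cell^(N−1)); occ(cΦ) = occ(Φ)). [difficulty: provable-now] -/
@[route_item "route-AtomisticToContinuum-BECLiebAntibunching", crux]
def PeriodicOccupationStability : Prop :=
  ∀ (N : ℕ) (L : ℝ), 0 < L → ∀ (Ψ Φ : Literature.MathematicalPhysics.QuantumManyBody.BoseGas.PeriodicTrialState N L) (c : ℂ), ‖c‖ = 1 → Literature.MathematicalPhysics.QuantumManyBody.BoseGas.condensateOccupation N L Ψ.ψ ^ (1 / 2 : ℝ) ≤ Literature.MathematicalPhysics.QuantumManyBody.BoseGas.condensateOccupation N L Φ.ψ ^ (1 / 2 : ℝ) + (N : ENNReal) ^ (1 / 2 : ℝ) * (∫⁻ X in Literature.MathematicalPhysics.QuantumManyBody.BoseGas.cellN N L, (‖Ψ.ψ X - c * Φ.ψ X‖₊ : ENNReal) ^ 2) ^ (1 / 2 : ℝ)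

/-- `PeriodicOccupationStability` holds: proved by `Summit.AtomisticToContinuum.BoseEinsteinCondensation.Theorems.periodicOccupationStability_proof`. -/
theorem PeriodicOccupationStability_holds : PeriodicOccupationStability := _root_.Summit.AtomisticToContinuum.BoseEinsteinCondensation.Theorems.periodicOccupationStability_proof

/-- item stmt-AtomisticToContinuum-9165 · support · rank 9 · open · by planner
sources: LSSY2005, PenroseOnsager1956
[support] FRAME GLUE (pure bookkeeping once the two support inequalities are available; filed as an
item so that the deciding theorem `closes` is term-mode logic): PalmAffinityBound → PeriodicRigidity
→ PalmAffinityFlatMode → PeriodicOccupationStability → PeriodicBEC-body (verbatim the body of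
stmt-AtomisticToContinuum-0826: ∀ admissible v ∃ρ₀ ∀ρ<ρ₀ ∃c>0 ∀ᶠN ∃δ>0 ∀ δ-near-minimisers Ψ of the
periodic energy, c·N ≤ condensateOccupation). Proof: fix v; ρ₀ = min; c := e^(−C)/4; eventually in N
= n+1 (index shift n ↦ n+1 under atTop) take η := e^(−C)/4 in PeriodicRigidity to get δ; the
∃-witness Ψ of PalmAffinityBound at δ has condensateOccupation ≥ e^(−C)N by PalmAffinityFlatMode;
for any δ-near-minimiser Φ, rigidity + PeriodicOccupationStability give
condensateOccupation(Φ)^(1/2) ≥ (e^(−C)N)^(1/2) − (Nη)^(1/2) = (e^(−C)N)^(1/2)/2. ENNReal arithmetic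
only. [difficulty: provable-now] -/
@[route_item "route-AtomisticToContinuum-BECLiebAntibunching", crux]
def AffinityFrameGlue : Prop :=
  PalmAffinityBound → PeriodicRigidity → PalmAffinityFlatMode → PeriodicOccupationStability → ∀ v : ℝ → ENNReal, Literature.MathematicalPhysics.QuantumManyBody.BoseGas.IsRepulsiveFiniteRange v → ∃ ρ₀ : ℝ, 0 < ρ₀ ∧ ∀ ρ : ℝ, 0 < ρ → ρ < ρ₀ → ∃ c : ℝ, 0 < c ∧ ∀ᶠ N : ℕ in Filter.atTop, ∃ δ : ENNReal, 0 < δ ∧ ∀ Ψ : Literature.MathematicalPhysics.QuantumManyBody.BoseGas.PeriodicTrialState N (Literature.MathematicalPhysics.QuantumManyBody.BoseGas.sideLength ρ N), Literature.MathematicalPhysics.QuantumManyBody.BoseGas.periodicEnergy v Ψ ≤ Literature.MathematicalPhysics.QuantumManyBody.BoseGas.periodicGroundStateEnergy v N (Literature.MathematicalPhysics.QuantumManyBody.BoseGas.sideLength ρ N) + δ → ENNReal.ofReal (c * N) ≤ Literature.MathematicalPhysics.QuantumManyBody.BoseGas.condensateOccupation N (Literature.MathematicalPhysics.QuantumManyBody.BoseGas.sideLength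 ρ N) Ψ.ψ

/-- item stmt-AtomisticToContinuum-10245 · assembly · rank 1 · open · by planner
sources: LSSY2005, Lieb1963, Reatto1969
[assembly] AntibunchingGS → NonPairwisePalmMean → PositiveGroundState → HardCorePalmAffinity →
AntibunchingPalmGlue → PeriodicRigidity → PalmAffinityFlatMode → PeriodicOccupationStability →
AffinityFrameGlue → BoundaryTransferWeak → BoseEinsteinCondensation (the sub-problem Statement decl,
by name); `closes` of exactly this shape is supplied in glue.lean (PalmJensen and
AntibunchingBoundsS are listed supports outside the deciding chain: the lemma of the glue and the
stand-alone S-bound). -/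
@[route_item "route-AtomisticToContinuum-BECLiebAntibunching"]
def Assembly : Prop :=
  AntibunchingGS → NonPairwisePalmMean → PositiveGroundState → HardCorePalmAffinity → AntibunchingPalmGlue → PeriodicRigidity → PalmAffinityFlatMode → PeriodicOccupationStability → AffinityFrameGlue → BoundaryTransferWeak → BoseEinsteinCondensation

/-! D-0027 §2.1 — DECIDING THEOREM (planner-authored via `route open/edit --closes-file`; by planner-plancard-AtomisticToContinuum-BoseEin-10c66410-0 2026-08-15T15:45:49Z):
its hypotheses are this route's items and its conclusion the sub-problem Statement (glue_lint), and it elaborates with this file. -/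

@[closes "route-AtomisticToContinuum-BECLiebAntibunching"] theorem closes (hA : AntibunchingGS) (hB : NonPairwisePalmMean) (hC : PositiveGroundState) (hD : HardCorePalmAffinity) (hG₁ : AntibunchingPalmGlue) (hR : PeriodicRigidity) (hF : PalmAffinityFlatMode) (hS : PeriodicOccupationStability) (hG : AffinityFrameGlue) (hT : BoundaryTransferWeak) : BoseEinsteinCondensation :=
  fun v hv => hT v hv ((hG (hG₁ hA hB hC hD) hR hF hS) v hv)

end Summit.AtomisticToContinuum.BoseEinsteinCondensation.Theses.BECLiebAntibunching
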